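import Summits.CriticalPhenomena.Ising3DConformalLimit.Theses.ClusterRigidity
import Summits.CriticalPhenomena.Ising3DConformalLimit.Theorems.EnergyNotSigmaSquaredMoebiusLimitExistsDefs
import Summits.CriticalPhenomena.Ising3DConformalLimit.Theorems.MoebiusLimitExists.Negative.PinnedClusterPoints

/-! EXACTNESS of the birth cut for `ClusterRigidity.ClusterPointsMoebius` (stmt-CriticalPhenomena-4657):
crux ⇒ STUB A, crux ⇒ STUB B, crux ⇒ STUB C (so no stub is stronger than the crux; with the skeleton's
A ∧ B ∧ C ⇒ crux the cut is exact). Sorry-free. Planner scratch, not published as a theorem. -/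

noncomputable section

open Filter Topology
open Literature.Probability.LatticeModels
open Summit.CriticalPhenomena.Ising3DConformalLimit.MoebiusLimitExistsOnlyInteraction
open Summit.CriticalPhenomena.Ising3DConformalLimit.Theses
open Summit.CriticalPhenomena.Ising3DConformalLimit.PinnedClusterPoints (clusterPoint_cfg01)

namespace ClusterPointsMoebiusExactness

theorem selfNormalisation_eq_rhoPin :
    (fun δ : ℝ => (criticalTwoPoint 3 (Pi.single 0 ⌊δ⁻¹⌋)) ^ (-(1/2:ℝ))) = rhoPin := by
  funext δ
  simp only [rhoPin, one_div]

/-- index re-parametrisation of locally uniform convergence -/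
theorem tluo_comp_index {α β : Type*} [TopologicalSpace α] [UniformSpace β] {F : ℕ → α → β} {f : α → β}
    {s : Set α} (h : TendstoLocallyUniformlyOn F f atTop s) {g : ℕ → ℕ} (hg : Tendsto g atTop atTop) :
    TendstoLocallyUniformlyOn (fun k => F (g k)) f atTop s := by
  intro u hu x hx
  obtain ⟨t, ht, hev⟩ := h u hu x hx
  exact ⟨t, ht, hg.eventually hev⟩

/-- converse dictionary: a normalised cluster point satisfies the crux's antecedent (shift the mesh sequence past
the finitely many terms outside `(0,1]`). -/
theorem hyp_of_isClusterPoint {S : CorrFamily 3} (hN : IsNormalised S) (hcp : IsClusterPoint S) :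
    (∀ n x, x ∉ NonCoincident 3 n → S n x = 0) ∧ ∃ u : ℕ → ℝ, (∀ k, u k ∈ Set.Ioc (0:ℝ) 1) ∧
      Tendsto u atTop (nhds 0) ∧ ∀ n, TendstoLocallyUniformlyOn
        (fun k => rescaledCorrelator (criticalCorr 3)
          (fun δ : ℝ => (criticalTwoPoint 3 (Pi.single 0 ⌊δ⁻¹⌋)) ^ (-(1/2:ℝ))) n (u k))
        (S n) atTop (NonCoincident 3 n) := by
  obtain ⟨u, hu, hconv⟩ := hcp
  have hu0 : Tendsto u atTop (𝓝 0) := (tendsto_nhdsWithin_iff.1 hu).1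
  have hupos : ∀ᶠ k in atTop, 0 < u k := (tendsto_nhdsWithin_iff.1 hu).2
  have hu1 : ∀ᶠ k in atTop, u k ≤ 1 := hu0.eventually (ge_mem_nhds one_pos)
  obtain ⟨K, hK⟩ := eventually_atTop.1 (hupos.and hu1)
  refine ⟨hN, fun k => u (k + K), fun k => ?_, ?_, fun n => ?_⟩
  · exact hK (k + K) (Nat.le_add_left K k)
  · exact hu0.comp (tendsto_add_atTop_nat K)
  · rw [selfNormalisation_eq_rhoPin]
    exact tluo_comp_index (hconv n) (tendsto_add_atTop_nat K)

/-- crux ⇒ STUB B -/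
theorem stubB_of_crux (h : ClusterRigidity.ClusterPointsMoebius) :
    ∀ (Δ : ℝ) (S : CorrFamily 3), IsClusterPoint S → IsNormalised S → IsNondegenerateTwoPoint S →
      IsTranslationInvariant S → 0 < Δ → IsScaleCovariant Δ S → IsRotationInvariant S := by
  intro Δ S hcp hN _ _ _ _
  obtain ⟨Δ', -, hM⟩ := h S (hyp_of_isClusterPoint hN hcp)
  exact hM.1.2

/-- the configuration `(0, e₀)` and its dilate -/
theorem two_smul_cfg01 :
    (fun i => (2:ℝ) • (![0, EuclideanSpace.single 0 1] : Fin 2 → EuclideanSpace ℝ (Fin 3)) i) =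
      ![0, (2:ℝ) • EuclideanSpace.single 0 1] := by
  funext i
  fin_cases i <;> simp

/-- two scale covariances of a cluster point have the same exponent (`S₂(0,e₀) = 1`). -/
theorem delta_unique {Δ Δ' : ℝ} {S : CorrFamily 3} (hcp : IsClusterPoint S)
    (h : IsScaleCovariant Δ S) (h' : IsScaleCovariant Δ' S) : Δ = Δ' := by
  have e1 := h 2 2 two_pos ![0, EuclideanSpace.single 0 1]
  have e2 := h' 2 2 two_pos ![0, EuclideanSpace.single 0 1]
  rw [clusterPoint_cfg01 hcp, mul_one] at e1 e2
  have e : (2:ℝ) ^ (-(2:ℝ) * Δ) = (2:ℝ) ^ (-(2:ℝ) * Δ') := by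
    have := e1.symm.trans e2
    exact_mod_cast this
  have := (Real.rpow_right_inj (x := (2:ℝ)) two_pos (by norm_num)).1 e
  linarith

/-- crux ⇒ STUB C -/
theorem stubC_of_crux (h : ClusterRigidity.ClusterPointsMoebius) :
    ∀ (Δ : ℝ) (S : CorrFamily 3), IsClusterPoint S → IsNormalised S → IsNondegenerateTwoPoint S →
      IsEuclideanInvariant S → 0 < Δ → IsScaleCovariant Δ S → IsInversionCovariant Δ S := by
  intro Δ S hcp hN _ _ _ hsc
  obtain ⟨Δ', -, hM⟩ := h S (hyp_of_isClusterPoint hN hcp)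
  have : Δ = Δ' := delta_unique hcp hsc hM.2.1
  subst this
  exact hM.2.2

/-- crux ⇒ STUB A (non-degeneracy: move a pair to `(0, ‖v‖e₀)` by a translation and a reflection, scale to
`(0,e₀)`, where `S₂ = 1`). -/
theorem stubA_of_crux (h : ClusterRigidity.ClusterPointsMoebius) :
    ∀ S : CorrFamily 3, IsClusterPoint S → IsNormalised S →
      IsTranslationInvariant S ∧ IsNondegenerateTwoPoint S ∧ ∃ Δ : ℝ, 0 < Δ ∧ IsScaleCovariant Δ S := by
  intro S hcp hN
  obtain ⟨Δ, hΔ, hM⟩ := h S (hyp_of_isClusterPoint hN hcp)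
  obtain ⟨⟨htr, hrot⟩, hsc, -⟩ := hM
  refine ⟨htr, ?_, Δ, hΔ, hsc⟩
  intro x hx
  set v : EuclideanSpace ℝ (Fin 3) := x 1 - x 0 with hv
  have hv0 : v ≠ 0 := by
    intro h0
    have : x 1 = x 0 := sub_eq_zero.1 (hv ▸ h0)
    exact absurd (((mem_nonCoincident x).1 hx) this) (by decide)
  have hnv : 0 < ‖v‖ := norm_pos_iff.2 hv0
  -- translate `x 0` to the origin
  have h1 : S 2 x = S 2 ![0, v] := by
    have := htr 2 (-x 0) x
    rw [← this]
    congr 1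
    funext i
    fin_cases i <;> simp [hv, sub_eq_add_neg]
  -- reflect `v` onto `‖v‖ e₀`
  set w : EuclideanSpace ℝ (Fin 3) := ‖v‖ • EuclideanSpace.single 0 1 with hw
  have hvw : ‖v‖ = ‖w‖ := by
    rw [hw, norm_smul, Real.norm_of_nonneg hnv.le, PiLp.norm_single, norm_one, mul_one]
  have h2 : S 2 ![0, v] = S 2 ![0, w] := by
    have := hrot 2 (Submodule.reflection (ℝ ∙ (v - w))ᗮ) ![0, v]
    rw [← this]
    congr 1
    funext i
    fin_cases i
    · simp
    · simpa using Submodule.reflection_sub hvw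
  -- scale `(0, ‖v‖e₀)` to `(0, e₀)`
  have h3 : S 2 ![0, w] = ‖v‖ ^ (-((2:ℕ):ℝ) * Δ) * 1 := by
    have := hsc 2 ‖v‖ hnv ![0, EuclideanSpace.single 0 1]
    rw [clusterPoint_cfg01 hcp] at this
    rw [← this]
    congr 1
    funext i
    fin_cases i <;> simp [hw]
  rw [h1, h2, h3, mul_one]
  exact Real.rpow_pos_of_pos hnv _

end ClusterPointsMoebiusExactness

end
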